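import Summits.CriticalPhenomena.CardyFormulaZ2.Theorems.CardyMagicRigidityNestingRigidityNeckZ2GatedFourArm
import HarnessLib

/-!
# Crux `NestingRigidity`, line `pinch-resampling` (v4), stub S12: structure of the gated four-arm event (free ranges are honest, minimal gates are beads, beads nest)

Crux `Summit.CriticalPhenomena.CardyFormulaZ2.Theses.CardyMagicRigidity.NestingRigidity`
(stmt-CriticalPhenomena-4835), line `pinch-resampling` v4, stub S12 `stub_neckHookupCoarseZ2 : NeckHookupCoarseZ2`.
Sequel of `…NeckZ2GatedFourArm` (worker W6b, wave 6): the DETERMINISTIC structure of the gated four-arm event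
`ZGatedFourArm lam s x w r R` behind the named `𝔅`-input `ZGatedFourArmBound` of stub S12 — the first step of any proof
of that bound, and the exact form of the "radial necklace" recursion it has to sum.  On a lattice configuration:

* §1 **Shrinking** (`NeckCoarseZ2.zGated_shrink`): the gated data on `zAnn w r R` restrict to every `zAnn w r' R'`,
  `r < r' ≤ R' ≤ R`, with the same gates and the new starts joined to the old ones.
* §2 **Free radial ranges are honest** (`NeckCoarseZ2.fourArmTwoClustersAt_of_gated_free`): if no gate `c` has
  `|c - w|_∞` within `lam` of `[r', R']`, the tree's honest event `fourArmTwoClustersAt w r' R'` holds (the sub-annulus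
  avoids every gate blob, so a joining path inside it would join the two sides inside the avoiding set).
* §3 **Minimal gate families are necklaces of beads** (`NeckCoarseZ2.exists_minimal_gates`, `NeckCoarseZ2.bead_of_minimal`):
  the gate family may be shrunk to a minimal one, and then EVERY gate blob is joined by an open edge to a vertex reachable
  from the first start and to a vertex reachable from the second start inside the avoiding annulus.
* §4 **Beads nest** (`NeckCoarseZ2.zGated_nest`): around every bead `c` of a minimal family the gated event holds again,
  `ω ∈ ZGatedFourArm lam s x c (lam + 1) t`, for every `t ≥ lam + 1` with `r + t ≤ |c - w|_∞ ≤ R - t`.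
* §5 The assembled structure theorem `zGatedFourArm_structure` (registered anchor).

Consequence for the bound (paper level, recorded for the next prover): splitting at the innermost bead radius `ρ₁`
gives `P(G(r,R)) ≤ P(H(r,R)) + Σ_ρ₁ (2ρ₁/lam) · P(H(r, ρ₁/2)) · P(G_bead(2lam+1, ρ₁/4)) · P(G(2ρ₁, R))` over disjoint
regions (`H` honest, `G` gated); with `P(H) ≤ C ρ^{-(1+ε)}` this recursion is QUADRATIC in the unknown bound with
coefficient `≍ C Σ_j (lam/2^j)^ε = O(C/ε)` and does not close by itself — nested bead clusters at bounded ratios near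
the inner scale `lam` are the whole difficulty (the same bounded-ratio necklace regime as for `ZNodeAbsBoundB`).
-/

noncomputable section

namespace Summit.CriticalPhenomena.CardyFormulaZ2.Cruxes.NestingRigidity.PinchResampling

open MeasureTheory Set Literature.Probability.Percolation Literature.Probability.LatticeModels
open ZPinchLocality
open NeckCoarseZ2

namespace NeckCoarseZ2

variable {lam s : ℕ} {x w : Site 2} {ω : BondConfig (Site 2)} {r R : ℕ} {F : Finset (Site 2)} {p₁ q₁ p₂ q₂ : Site 2}

/-! ## §1 Shrinking the annulus -/

/-- A smaller annulus (larger inner radius, smaller outer radius) lies inside the larger one. -/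
theorem zAnn_subset_zAnn {r R r' R' : ℕ} (hr : r ≤ r') (hR : R' ≤ R) : zAnn w r' R' ⊆ zAnn w r R := by
  rintro z ⟨hz1, hz2⟩
  exact ⟨by omega, by omega⟩

/-- **Shrinking the gated data**: crossings of `zAnn w r R` inside the avoiding set, not joined there, restrict to
crossings of every `zAnn w r' R'` (`r < r' ≤ R' ≤ R`) inside the avoiding set, not joined there, whose starts are
joined to the old starts inside the old avoiding annulus. -/
theorem zGated_shrink (hHG : ∀ a b, (openGraph ω).Adj a b → (zdGraph 2).Adj a b)
    (hp₁ : zNorm (p₁ - w) = r) (hq₁ : zNorm (q₁ - w) = R) (hp₂ : zNorm (p₂ - w) = r) (hq₂ : zNorm (q₂ - w) = R)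
    (h₁ : PathIn (openGraph ω) (zAnn w r R ∩ zAvoid s x ω ↑F) p₁ q₁)
    (h₂ : PathIn (openGraph ω) (zAnn w r R ∩ zAvoid s x ω ↑F) p₂ q₂)
    (hn : ¬ PathIn (openGraph ω) (zAnn w r R ∩ zAvoid s x ω ↑F) p₁ p₂)
    {r' R' : ℕ} (hrr' : r < r') (hr'R' : r' ≤ R') (hR'R : R' ≤ R) :
    ∃ p₁' q₁' p₂' q₂', zNorm (p₁' - w) = r' ∧ zNorm (q₁' - w) = R' ∧ zNorm (p₂' - w) = r' ∧ zNorm (q₂' - w) = R' ∧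
      PathIn (openGraph ω) (zAnn w r' R' ∩ zAvoid s x ω ↑F) p₁' q₁' ∧
      PathIn (openGraph ω) (zAnn w r' R' ∩ zAvoid s x ω ↑F) p₂' q₂' ∧
      ¬ PathIn (openGraph ω) (zAnn w r' R' ∩ zAvoid s x ω ↑F) p₁' p₂' ∧
      PathIn (openGraph ω) (zAnn w r R ∩ zAvoid s x ω ↑F) p₁ p₁' ∧
      PathIn (openGraph ω) (zAnn w r R ∩ zAvoid s x ω ↑F) p₂ p₂' := by
  set S := zAnn w r R ∩ zAvoid s x ω ↑F with hS
  obtain ⟨p₁', q₁', hp₁', hq₁', hc₁, hj₁⟩ :=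
    exists_zAnn_crossing_of_pathIn hHG hr'R' (show zNorm (p₁ - w) < r' by omega) (show (R' : ℤ) ≤ zNorm (q₁ - w) by omega) h₁
  obtain ⟨p₂', q₂', hp₂', hq₂', hc₂, hj₂⟩ :=
    exists_zAnn_crossing_of_pathIn hHG hr'R' (show zNorm (p₂ - w) < r' by omega) (show (R' : ℤ) ≤ zNorm (q₂ - w) by omega) h₂
  have hsub : S ∩ zAnn w r' R' ⊆ zAnn w r' R' ∩ zAvoid s x ω ↑F := fun z hz ↦ ⟨hz.2, hz.1.2⟩
  have hsub' : zAnn w r' R' ∩ zAvoid s x ω ↑F ⊆ S := fun z hz ↦ ⟨zAnn_subset_zAnn hrr'.le hR'R hz.1, hz.2⟩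
  refine ⟨p₁', q₁', p₂', q₂', hp₁', hq₁', hp₂', hq₂', hc₁.mono hsub, hc₂.mono hsub, fun h ↦ hn ?_, hj₁, hj₂⟩
  exact (hj₁.trans (h.mono hsub')).trans hj₂.symm

/-! ## §2 Free radial ranges are honest -/

/-- A sub-annulus none of whose radii is within `lam` of the radius of a gate avoids all gate blobs. -/
theorem zAnn_subset_zAvoid_of_free (hw : w ∈ innerLayer (zdGraph 2) (zBall x s) (zBall x (2 * s)))
    (hF : ∀ c ∈ F, c ∈ innerLayer (zdGraph 2) (zBall x s) (zBall x (2 * s)) ∧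
      ¬ ∃ u ∈ blobOf (openGraph ω) (zBall x (2 * s) \ zBall x s) c,
        ∃ u' ∈ blobOf (openGraph ω) (zBall x (2 * s) \ zBall x s) c, (lam : ℤ) ≤ zNorm (u - u'))
    {r' R' : ℕ} (hR's : R' + 1 ≤ s)
    (hfree : ∀ c ∈ F, zNorm (c - w) + lam ≤ r' ∨ (R' : ℤ) + lam ≤ zNorm (c - w)) :
    zAnn w r' R' ⊆ zAvoid s x ω ↑F := by
  intro z hz
  refine ⟨zAnn_subset_zBall hw hR's hz, fun hz' ↦ ?_⟩
  simp only [mem_iUnion, Finset.mem_coe, exists_prop] at hz'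
  obtain ⟨c, hc, hzc⟩ := hz'
  have hd := zNorm_sub_lt_of_small (hF c hc).2 hzc (NeckCoarse.self_mem_blobOf (hF c hc).1.1)
  have h1 := zNorm_sub_le_add z c w
  have h2 := zNorm_sub_le_add c z w
  have h3 : zNorm (c - z) = zNorm (z - c) := zNorm_sub_comm _ _
  obtain ⟨hzr, hzR⟩ := hz
  rcases hfree c hc with h | h <;> omega

/-- **Free radial ranges are honest**: with gated data on `zAnn w r R` (gates `F`), every sub-annulus `zAnn w r' R'`
(`r < r' ≤ R' ≤ R ≤ s - 1`) with no gate radius within `lam` of `[r', R']` carries the honest four-arm event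
`fourArmTwoClustersAt w r' R'`. -/
theorem fourArmTwoClustersAt_of_gated_free (hHG : ∀ a b, (openGraph ω).Adj a b → (zdGraph 2).Adj a b)
    (hw : w ∈ innerLayer (zdGraph 2) (zBall x s) (zBall x (2 * s)))
    (hF : ∀ c ∈ F, c ∈ innerLayer (zdGraph 2) (zBall x s) (zBall x (2 * s)) ∧
      ¬ ∃ u ∈ blobOf (openGraph ω) (zBall x (2 * s) \ zBall x s) c,
        ∃ u' ∈ blobOf (openGraph ω) (zBall x (2 * s) \ zBall x s) c, (lam : ℤ) ≤ zNorm (u - u'))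
    (hp₁ : zNorm (p₁ - w) = r) (hq₁ : zNorm (q₁ - w) = R) (hp₂ : zNorm (p₂ - w) = r) (hq₂ : zNorm (q₂ - w) = R)
    (h₁ : PathIn (openGraph ω) (zAnn w r R ∩ zAvoid s x ω ↑F) p₁ q₁)
    (h₂ : PathIn (openGraph ω) (zAnn w r R ∩ zAvoid s x ω ↑F) p₂ q₂)
    (hn : ¬ PathIn (openGraph ω) (zAnn w r R ∩ zAvoid s x ω ↑F) p₁ p₂) (hRs : R + 1 ≤ s)
    {r' R' : ℕ} (hrr' : r < r') (hr'R' : r' ≤ R') (hR'R : R' ≤ R)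
    (hfree : ∀ c ∈ F, zNorm (c - w) + lam ≤ r' ∨ (R' : ℤ) + lam ≤ zNorm (c - w)) :
    ω ∈ fourArmTwoClustersAt w r' R' := by
  obtain ⟨p₁', q₁', p₂', q₂', hp₁', hq₁', hp₂', hq₂', hc₁, hc₂, hn', -, -⟩ :=
    zGated_shrink hHG hp₁ hq₁ hp₂ hq₂ h₁ h₂ hn hrr' hr'R' hR'R
  have hAnn := zAnn_subset_zAvoid_of_free hw hF (show R' + 1 ≤ s by omega) hfree
  refine mem_fourArmTwoClustersAt_of_crossings (by omega) hr'R' hp₁' hq₁' hp₂' hq₂' (hc₁.mono inter_subset_left)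
    (hc₂.mono inter_subset_left) fun h ↦ hn' (h.mono fun z hz ↦ ⟨hz, hAnn hz⟩)

/-! ## §3 Minimal gate families are necklaces of beads -/

/-- Fewer gates avoid less. -/
theorem zAvoid_mono {F F' : Finset (Site 2)} (h : F' ⊆ F) : zAvoid s x ω ↑F ⊆ zAvoid s x ω ↑F' := by
  rintro z ⟨hzO, hz⟩
  refine ⟨hzO, fun hz' ↦ hz ?_⟩
  simp only [mem_iUnion, Finset.mem_coe, exists_prop] at hz' ⊢
  obtain ⟨c, hc, hzc⟩ := hz'
  exact ⟨c, h hc, hzc⟩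

/-- **A minimal gate family**: the gates may be shrunk to a sub-family which still separates the two crossings but
none of whose members can be dropped. -/
theorem exists_minimal_gates (h₁ : PathIn (openGraph ω) (zAnn w r R ∩ zAvoid s x ω ↑F) p₁ q₁)
    (h₂ : PathIn (openGraph ω) (zAnn w r R ∩ zAvoid s x ω ↑F) p₂ q₂)
    (hn : ¬ PathIn (openGraph ω) (zAnn w r R ∩ zAvoid s x ω ↑F) p₁ p₂) :
    ∃ F₀ ⊆ F, PathIn (openGraph ω) (zAnn w r R ∩ zAvoid s x ω ↑F₀) p₁ q₁ ∧
      PathIn (openGraph ω) (zAnn w r R ∩ zAvoid s x ω ↑F₀) p₂ q₂ ∧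
      ¬ PathIn (openGraph ω) (zAnn w r R ∩ zAvoid s x ω ↑F₀) p₁ p₂ ∧
      ∀ c ∈ F₀, PathIn (openGraph ω) (zAnn w r R ∩ zAvoid s x ω ↑(F₀ \ {c})) p₁ p₂ := by
  classical
  let P : Finset (Site 2) → Prop := fun F' ↦ ¬ PathIn (openGraph ω) (zAnn w r R ∩ zAvoid s x ω ↑F') p₁ p₂
  set 𝒞 := F.powerset.filter P with h𝒞
  have hF𝒞 : F ∈ 𝒞 := Finset.mem_filter.2 ⟨Finset.mem_powerset.2 subset_rfl, hn⟩
  obtain ⟨F₀, hF₀𝒞, hmin⟩ := Finset.exists_min_image 𝒞 Finset.card ⟨F, hF𝒞⟩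
  obtain ⟨hF₀F, hF₀P⟩ := Finset.mem_filter.1 hF₀𝒞
  have hsub : F₀ ⊆ F := Finset.mem_powerset.1 hF₀F
  have hmono : zAnn w r R ∩ zAvoid s x ω ↑F ⊆ zAnn w r R ∩ zAvoid s x ω ↑F₀ :=
    inter_subset_inter_right _ (zAvoid_mono hsub)
  refine ⟨F₀, hsub, h₁.mono hmono, h₂.mono hmono, hF₀P, fun c hc ↦ ?_⟩
  by_contra hch
  have hmem : F₀ \ {c} ∈ 𝒞 :=
    Finset.mem_filter.2 ⟨Finset.mem_powerset.2 (Finset.sdiff_subset.trans hsub), hch⟩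
  have h1 := hmin _ hmem
  have h2 : (F₀ \ {c}).card < F₀.card := Finset.card_lt_card (Finset.sdiff_ssubset (by simpa using hc) (by simp))
  omega

/-- Outside the blob of `c`, avoiding the other gates is avoiding all gates. -/
theorem compl_blob_inter_subset {c : Site 2} :
    (blobOf (openGraph ω) (zBall x (2 * s) \ zBall x s) c)ᶜ ∩ (zAnn w r R ∩ zAvoid s x ω ↑(F \ {c})) ⊆
      zAnn w r R ∩ zAvoid s x ω ↑F := by
  classical
  rintro z ⟨hzc, hzA, hzO, hzF⟩
  refine ⟨hzA, hzO, fun hz ↦ ?_⟩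
  simp only [mem_iUnion, Finset.mem_coe, exists_prop] at hz hzF
  obtain ⟨c', hc', hzc'⟩ := hz
  by_cases hcc : c' = c
  · subst hcc; exact hzc hzc'
  · exact hzF ⟨c', Finset.mem_sdiff.2 ⟨hc', by simpa using hcc⟩, hzc'⟩

/-- **Every gate of a minimal family is a bead, seen from one side**: if dropping the gate `c` would join the two
starts, the blob of `c` is joined by an open edge to a vertex reachable from the first start inside the avoiding
annulus. -/
theorem bead_side {c : Site 2} (hc : c ∈ F)
    (hp₁ : p₁ ∈ zAnn w r R ∩ zAvoid s x ω ↑F)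
    (hn : ¬ PathIn (openGraph ω) (zAnn w r R ∩ zAvoid s x ω ↑F) p₁ p₂)
    (hρ : PathIn (openGraph ω) (zAnn w r R ∩ zAvoid s x ω ↑(F \ {c})) p₁ p₂) :
    ∃ a cc, PathIn (openGraph ω) (zAnn w r R ∩ zAvoid s x ω ↑F) p₁ a ∧ (openGraph ω).Adj a cc ∧
      cc ∈ blobOf (openGraph ω) (zBall x (2 * s) \ zBall x s) c := by
  have hp₁c : p₁ ∈ (blobOf (openGraph ω) (zBall x (2 * s) \ zBall x s) c)ᶜ := by
    intro h
    refine hp₁.2.2 ?_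
    simp only [mem_iUnion, Finset.mem_coe, exists_prop]
    exact ⟨c, hc, h⟩
  rcases hρ.exit_or (R := (blobOf (openGraph ω) (zBall x (2 * s) \ zBall x s) c)ᶜ) hp₁c with
    hstay | ⟨a, cc, -, hccR, -, hadj, hpref⟩
  · exact (hn (hstay.mono compl_blob_inter_subset)).elim
  · simp only [mem_compl_iff, not_not] at hccR
    exact ⟨a, cc, hpref.mono compl_blob_inter_subset, hadj, hccR⟩

/-- **Every gate of a minimal family is a bead**: its blob is joined by open edges to vertices reachable from BOTH starts
inside the avoiding annulus. -/
theorem bead_of_minimal {c : Site 2} (hc : c ∈ F)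
    (h₁ : PathIn (openGraph ω) (zAnn w r R ∩ zAvoid s x ω ↑F) p₁ q₁)
    (h₂ : PathIn (openGraph ω) (zAnn w r R ∩ zAvoid s x ω ↑F) p₂ q₂)
    (hn : ¬ PathIn (openGraph ω) (zAnn w r R ∩ zAvoid s x ω ↑F) p₁ p₂)
    (hρ : PathIn (openGraph ω) (zAnn w r R ∩ zAvoid s x ω ↑(F \ {c})) p₁ p₂) :
    ∃ a₁ c₁ a₂ c₂, PathIn (openGraph ω) (zAnn w r R ∩ zAvoid s x ω ↑F) p₁ a₁ ∧ (openGraph ω).Adj a₁ c₁ ∧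
      c₁ ∈ blobOf (openGraph ω) (zBall x (2 * s) \ zBall x s) c ∧
      PathIn (openGraph ω) (zAnn w r R ∩ zAvoid s x ω ↑F) p₂ a₂ ∧ (openGraph ω).Adj a₂ c₂ ∧
      c₂ ∈ blobOf (openGraph ω) (zBall x (2 * s) \ zBall x s) c := by
  obtain ⟨a₁, c₁, hpa₁, hadj₁, hc₁⟩ := bead_side hc h₁.left_mem hn hρ
  obtain ⟨a₂, c₂, hpa₂, hadj₂, hc₂⟩ := bead_side hc h₂.left_mem (fun h ↦ hn h.symm) hρ.symm
  exact ⟨a₁, c₁, a₂, c₂, hpa₁, hadj₁, hc₁, hpa₂, hadj₂, hc₂⟩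

/-! ## §4 Beads nest -/

/-- A small annulus around a point of the big annulus, radially well inside it, lies inside the big annulus. -/
theorem zAnn_bead_subset {c : Site 2} {r₀ t : ℕ} (hin : (r : ℤ) + t ≤ zNorm (c - w)) (hout : zNorm (c - w) + t ≤ R) :
    zAnn c r₀ t ⊆ zAnn w r R := by
  rintro z ⟨-, hz2⟩
  have h1 := zNorm_sub_le_add z c w
  have h2 := zNorm_sub_le_add c z w
  have h3 : zNorm (c - z) = zNorm (z - c) := zNorm_sub_comm _ _
  exact ⟨by omega, by omega⟩

/-- **Beads nest**: around a bead `c` of the gate family (joined by open edges to both sides inside the avoiding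
annulus), the gated four-arm event holds again from radius `lam + 1` to every radius `t ≥ lam + 1` with
`r + t ≤ |c - w|_∞ ≤ R - t` (the two sides enter `Λ_{lam}(c)` next to the blob of `c`, leave `Λ_{t-1}(c)` towards the
inner boundary of the big annulus, and are not joined inside the avoiding sub-annulus). -/
theorem zGated_nest (hHG : ∀ a b, (openGraph ω).Adj a b → (zdGraph 2).Adj a b)
    (hF : ∀ c ∈ F, c ∈ innerLayer (zdGraph 2) (zBall x s) (zBall x (2 * s)) ∧
      ¬ ∃ u ∈ blobOf (openGraph ω) (zBall x (2 * s) \ zBall x s) c,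
        ∃ u' ∈ blobOf (openGraph ω) (zBall x (2 * s) \ zBall x s) c, (lam : ℤ) ≤ zNorm (u - u'))
    (hp₁ : zNorm (p₁ - w) = r) (hp₂ : zNorm (p₂ - w) = r)
    (hn : ¬ PathIn (openGraph ω) (zAnn w r R ∩ zAvoid s x ω ↑F) p₁ p₂)
    {c : Site 2} (hc : c ∈ F) {a₁ c₁ a₂ c₂ : Site 2}
    (hpa₁ : PathIn (openGraph ω) (zAnn w r R ∩ zAvoid s x ω ↑F) p₁ a₁) (hadj₁ : (openGraph ω).Adj a₁ c₁)
    (hc₁ : c₁ ∈ blobOf (openGraph ω) (zBall x (2 * s) \ zBall x s) c)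
    (hpa₂ : PathIn (openGraph ω) (zAnn w r R ∩ zAvoid s x ω ↑F) p₂ a₂) (hadj₂ : (openGraph ω).Adj a₂ c₂)
    (hc₂ : c₂ ∈ blobOf (openGraph ω) (zBall x (2 * s) \ zBall x s) c)
    {t : ℕ} (ht : lam + 1 ≤ t) (hin : (r : ℤ) + t ≤ zNorm (c - w)) (hout : zNorm (c - w) + t ≤ R) :
    ω ∈ ZGatedFourArm lam s x c (lam + 1) t := by
  set S := zAnn w r R ∩ zAvoid s x ω ↑F with hS
  -- near: the entry points lie inside `Λ_{lam}(c)`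
  have hnear : ∀ {a cc : Site 2}, (openGraph ω).Adj a cc → cc ∈ blobOf (openGraph ω) (zBall x (2 * s) \ zBall x s) c →
      zNorm (a - c) < lam + 1 := by
    intro a cc hadj hcc
    have h1 : zNorm (a - cc) ≤ 1 := by
      have := zNorm_sub_le_of_adj (hHG _ _ hadj).symm cc
      have h0 : zNorm (cc - cc) = 0 := by simp [zNorm]
      omega
    have h2 := zNorm_sub_lt_of_small (hF c hc).2 hcc (NeckCoarse.self_mem_blobOf (hF c hc).1.1)
    have h4 := zNorm_sub_le_add a cc c
    omega
  -- far: the starts of the big crossings are at distance `≥ t` from `c`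
  have hfar : ∀ {p : Site 2}, zNorm (p - w) = r → (t : ℤ) ≤ zNorm (p - c) := by
    intro p hp
    have h1 := zNorm_sub_le_add c p w
    have h2 : zNorm (c - p) = zNorm (p - c) := zNorm_sub_comm _ _
    omega
  obtain ⟨p₁', q₁', hp₁', hq₁', hcr₁, hj₁⟩ := exists_zAnn_crossing_of_pathIn hHG ht (hnear hadj₁ hc₁) (hfar hp₁) hpa₁.symm
  obtain ⟨p₂', q₂', hp₂', hq₂', hcr₂, hj₂⟩ := exists_zAnn_crossing_of_pathIn hHG ht (hnear hadj₂ hc₂) (hfar hp₂) hpa₂.symm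
  have hsub : S ∩ zAnn c (lam + 1) t ⊆ zAnn c (lam + 1) t ∩ zAvoid s x ω ↑F := fun z hz ↦ ⟨hz.2, hz.1.2⟩
  have hsub' : zAnn c (lam + 1) t ∩ zAvoid s x ω ↑F ⊆ S := fun z hz ↦ ⟨zAnn_bead_subset hin hout hz.1, hz.2⟩
  refine ⟨F, hF, p₁', q₁', p₂', q₂', hp₁', hq₁', hp₂', hq₂', hcr₁.mono hsub, hcr₂.mono hsub, fun h ↦ hn ?_⟩
  exact ((hpa₁.trans hj₁).trans (h.mono hsub')).trans (hpa₂.trans hj₂).symm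

end NeckCoarseZ2

/-! ## §5 The structure theorem -/

/-- **Structure of the gated four-arm event (registered helper, anchor of this module on the crux item).**  On a lattice
configuration, for an inner-layer centre `w` and `R + 1 ≤ s`: the gated event on `zAnn w r R` is witnessed by a gate
family `F` (inner-layer vertices with small blobs) and two crossings such that (i) every sub-annulus `zAnn w r' R'`,
`r < r' ≤ R' ≤ R`, with no gate radius within `lam` of `[r', R']` carries the HONEST event `fourArmTwoClustersAt w r' R'`;
(ii) every gate is a bead — its blob is joined by open edges to vertices reachable from both starts inside the avoiding
annulus; (iii) around every gate `c` the gated event holds again, `ω ∈ ZGatedFourArm lam s x c (lam + 1) t`, for all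
`t ≥ lam + 1` with `r + t ≤ |c - w|_∞ ≤ R - t`. -/
theorem zGatedFourArm_structure : ∀ (lam s : ℕ) (x w : Site 2) (r R : ℕ) (ω : BondConfig (Site 2)), (∀ a b, (openGraph ω).Adj a b → (zdGraph 2).Adj a b) → w ∈ innerLayer (zdGraph 2) (zBall x s) (zBall x (2 * s)) → R + 1 ≤ s → ω ∈ ZGatedFourArm lam s x w r R → ∃ F : Finset (Site 2), (∀ c ∈ F, c ∈ innerLayer (zdGraph 2) (zBall x s) (zBall x (2 * s)) ∧ ¬ ∃ u ∈ blobOf (openGraph ω) (zBall x (2 * s) \ zBall x s) c, ∃ u' ∈ blobOf (openGraph ω) (zBall x (2 * s) \ zBall x s) c, (lam : ℤ) ≤ zNorm (u - u')) ∧ (∀ r' R' : ℕ, r < r' → r' ≤ R' → R' ≤ R → (∀ c ∈ F, zNorm (c - w) + lam ≤ r' ∨ (R' : ℤ) + lam ≤ zNorm (c - w)) → ω ∈ fourArmTwoClustersAt w r' R') ∧ (∃ p₁ q₁ p₂ q₂ : Site 2, zNorm (p₁ - w) = r ∧ zNorm (q₁ - w) = R ∧ zNorm (p₂ - w) = r ∧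 zNorm (q₂ - w) = R ∧ PathIn (openGraph ω) (NeckCoarseZ2.zAnn w r R ∩ NeckCoarseZ2.zAvoid s x ω ↑F) p₁ q₁ ∧ PathIn (openGraph ω) (NeckCoarseZ2.zAnn w r R ∩ NeckCoarseZ2.zAvoid s x ω ↑F) p₂ q₂ ∧ ¬ PathIn (openGraph ω) (NeckCoarseZ2.zAnn w r R ∩ NeckCoarseZ2.zAvoid s x ω ↑F) p₁ p₂ ∧ ∀ c ∈ F, ∃ a₁ c₁ a₂ c₂ : Site 2, PathIn (openGraph ω) (NeckCoarseZ2.zAnn w r R ∩ NeckCoarseZ2.zAvoid s x ω ↑F) p₁ a₁ ∧ (openGraph ω).Adj a₁ c₁ ∧ c₁ ∈ blobOf (openGraph ω) (zBall x (2 * s) \ zBall x s) c ∧ PathIn (openGraph ω) (NeckCoarseZ2.zAnn w r R ∩ NeckCoarseZ2.zAvoid s x ω ↑F) p₂ a₂ ∧ (openGraph ω).Adj a₂ c₂ ∧ c₂ ∈ blobOf (openGraph ω) (zBall x (2 * s) \ zBall x s) c) ∧ ∀ c ∈ F, ∀ t : ℕ, lam + 1 ≤ t → (r : ℤ) + t ≤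 zNorm (c - w) → zNorm (c - w) + t ≤ R → ω ∈ ZGatedFourArm lam s x c (lam + 1) t := by
  intro lam s x w r R ω hHG hw hRs hω
  obtain ⟨F, hF, p₁, q₁, p₂, q₂, hp₁, hq₁, hp₂, hq₂, h₁, h₂, hn⟩ := hω
  obtain ⟨F₀, hF₀F, h₁', h₂', hn', hmin⟩ := NeckCoarseZ2.exists_minimal_gates h₁ h₂ hn
  have hF₀ : ∀ c ∈ F₀, c ∈ innerLayer (zdGraph 2) (zBall x s) (zBall x (2 * s)) ∧
      ¬ ∃ u ∈ blobOf (openGraph ω) (zBall x (2 * s) \ zBall x s) c,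
        ∃ u' ∈ blobOf (openGraph ω) (zBall x (2 * s) \ zBall x s) c, (lam : ℤ) ≤ zNorm (u - u') :=
    fun c hc ↦ hF c (hF₀F hc)
  have hbead : ∀ c ∈ F₀, ∃ a₁ c₁ a₂ c₂ : Site 2, PathIn (openGraph ω) (zAnn w r R ∩ zAvoid s x ω ↑F₀) p₁ a₁ ∧
      (openGraph ω).Adj a₁ c₁ ∧ c₁ ∈ blobOf (openGraph ω) (zBall x (2 * s) \ zBall x s) c ∧
      PathIn (openGraph ω) (zAnn w r R ∩ zAvoid s x ω ↑F₀) p₂ a₂ ∧ (openGraph ω).Adj a₂ c₂ ∧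
      c₂ ∈ blobOf (openGraph ω) (zBall x (2 * s) \ zBall x s) c :=
    fun c hc ↦ NeckCoarseZ2.bead_of_minimal hc h₁' h₂' hn' (hmin c hc)
  refine ⟨F₀, hF₀, fun r' R' hrr' hr'R' hR'R hfree ↦
    NeckCoarseZ2.fourArmTwoClustersAt_of_gated_free hHG hw hF₀ hp₁ hq₁ hp₂ hq₂ h₁' h₂' hn' hRs hrr' hr'R' hR'R hfree,
    ⟨p₁, q₁, p₂, q₂, hp₁, hq₁, hp₂, hq₂, h₁', h₂', hn', hbead⟩, fun c hc t ht hin hout ↦ ?_⟩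
  obtain ⟨a₁, c₁, a₂, c₂, hpa₁, hadj₁, hc₁, hpa₂, hadj₂, hc₂⟩ := hbead c hc
  exact NeckCoarseZ2.zGated_nest hHG hF₀ hp₁ hp₂ hn' hc hpa₁ hadj₁ hc₁ hpa₂ hadj₂ hc₂ ht hin hout

end Summit.CriticalPhenomena.CardyFormulaZ2.Cruxes.NestingRigidity.PinchResampling

end
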